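import Summits.KontsevichZagierPeriods.KontsevichZagierPeriods.Theorems.LinRedNormalFormArrangementNormalFormSeparateTwoComparison

/-!
# Lower bounds for the fibre mass: slack cubes

(Line `janus-bands`, crux `ArrangementNormalForm`, stub `stub_separateTwo`, part `Volume`.)
The positivity brick of the fibre-mass theory of `stub_separateTwo`: (1) off the (null) letter
hits the letter block is at least `D^{-k}` when every lettered coordinate is within `D ≥ 1` of
its letter (`lblock_ge`), so `lmass ≥ D^{-k} · vol(cell)` (`lmass_ge_volume`); (2) a point `t₀`
of the cell of `α` with SLACK `σ` (every bound missed by at least `σ`) keeps the open cube of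
radius `σ/3` around it inside the cell of every valuation `α'` within `σ/3` of `α` on the bound
atoms (`cube_subset_cell`), a cube of volume `(2σ/3)^k` (`volume_cube`; `σ > 0` for a genuine point of the open cell). Hence the fibre mass
is bounded below by `(2σ/(3D))^k > 0` at all valuations near one whose cell has a slack point
(`lmass_ge_of_slack`, registered as `separateTwo_volume`): the anchor for power counting, for
`λ^e ∣ p` at polar lines crossing the open base, and for the confinement count at degenerating
edges in the roadmap of `stub_separateTwo`.
-/

noncomputable section

open Set MeasureTheory
open scoped ENNReal

namespace Summit.KontsevichZagierPeriods.ArrangementNormalForm.JanusBands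

namespace SepTwo

variable {k : ℕ} {ι : Type*}

/-- Off the letter hits, the letter block is at least `D⁻ᵏ` (`D ≥ 1` a bound for the distances
of the lettered coordinates to their letters). -/
theorem lblock_ge (a : Fin k → Option ι) (α : ι → ℝ) {D : ℝ} (hD : 1 ≤ D) (t : Fin k → ℝ)
    (h : ∀ i c, a i = some c → |t i - α c| ≤ D ∧ t i ≠ α c) :
    ENNReal.ofReal D⁻¹ ^ k ≤ lblock a α t := by
  unfold lblock
  have hk : ENNReal.ofReal D⁻¹ ^ k = ∏ _i : Fin k, ENNReal.ofReal D⁻¹ := by simp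
  rw [hk]
  refine Finset.prod_le_prod' fun i _ => ?_
  rcases hai : a i with _ | c
  · simp only [Option.elim_none]
    rw [← ENNReal.ofReal_one]
    exact ENNReal.ofReal_le_ofReal (inv_le_one_of_one_le₀ hD)
  · simp only [Option.elim_some]
    obtain ⟨h1, h2⟩ := h i c hai
    exact ENNReal.ofReal_le_ofReal (inv_anti₀ (abs_pos.2 (sub_ne_zero.2 h2)) h1)

/-- The possible letter values (with a harmless default for unlettered fibres). -/
def letterVals (a : Fin k → Option ι) (α : ι → ℝ) : Finset ℝ :=
  Finset.univ.image fun i => (a i).elim 0 α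

/-- **Mass ≥ D⁻ᵏ · volume.** -/
theorem lmass_ge_volume (lo hi : Fin k → Fin k ⊕ ι) (a : Fin k → Option ι) (α : ι → ℝ) {D : ℝ}
    (hD : 1 ≤ D) (h : ∀ t ∈ cell lo hi α, ∀ i c, a i = some c → |t i - α c| ≤ D) :
    ENNReal.ofReal D⁻¹ ^ k * volume (cell lo hi α) ≤ lmass lo hi a α := by
  classical
  set H := {t : Fin k → ℝ | ∃ i, t i ∈ (letterVals a α : Set ℝ)} with hH
  have hHnull : volume H = 0 := volume_grid_eq_zero _
  have hsub : cell lo hi α \ H ⊆ cell lo hi α := sdiff_subset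
  have hvol : volume (cell lo hi α \ H) = volume (cell lo hi α) := measure_sdiff_null hHnull
  calc ENNReal.ofReal D⁻¹ ^ k * volume (cell lo hi α)
      = ENNReal.ofReal D⁻¹ ^ k * volume (cell lo hi α \ H) := by rw [hvol]
    _ = ∫⁻ _t in cell lo hi α \ H, ENNReal.ofReal D⁻¹ ^ k := (setLIntegral_const _ _).symm
    _ ≤ ∫⁻ t in cell lo hi α \ H, lblock a α t := by
        refine setLIntegral_mono' ((measurableSet_cell lo hi α).diff ?_) fun t ht => ?_
        · have : H = ⋃ i, (fun t : Fin k → ℝ => t i) ⁻¹' (letterVals a α : Set ℝ) := by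
            ext t; simp [hH]
          rw [this]
          exact MeasurableSet.iUnion fun i => (measurable_pi_apply i) (letterVals a α).measurableSet
        · refine lblock_ge a α hD t fun i c hic => ⟨h t ht.1 i c hic, fun heq => ht.2 ⟨i, ?_⟩⟩
          rw [Finset.mem_coe, letterVals, Finset.mem_image]
          exact ⟨i, Finset.mem_univ _, by simp [hic, heq]⟩
    _ ≤ lmass lo hi a α := lintegral_mono_set hsub

/-- **Slack cubes stay in nearby cells.** -/
theorem cube_subset_cell (lo hi : Fin k → Fin k ⊕ ι) (α α' : ι → ℝ) (t₀ : Fin k → ℝ) (σ : ℝ)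
    (hslack : ∀ i, Sum.elim t₀ α (lo i) + σ ≤ t₀ i ∧ t₀ i + σ ≤ Sum.elim t₀ α (hi i))
    (hα' : ∀ i c, (lo i = Sum.inr c ∨ hi i = Sum.inr c) → |α' c - α c| ≤ σ / 3) :
    {t : Fin k → ℝ | ∀ i, |t i - t₀ i| < σ / 3} ⊆ cell lo hi α' := by
  intro t ht i
  obtain ⟨hl, hh⟩ := hslack i
  have hti := abs_lt.1 (ht i)
  constructor
  · revert hl
    rcases hlo : lo i with j | c
    · intro hl
      have htj := abs_lt.1 (ht j)
      simp only [Sum.elim_inl] at hl ⊢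
      linarith
    · intro hl
      have hc := abs_le.1 (hα' i c (Or.inl hlo))
      simp only [Sum.elim_inr] at hl ⊢
      linarith
  · revert hh
    rcases hhi : hi i with j | c
    · intro hh
      have htj := abs_lt.1 (ht j)
      simp only [Sum.elim_inl] at hh ⊢
      linarith
    · intro hh
      have hc := abs_le.1 (hα' i c (Or.inr hhi))
      simp only [Sum.elim_inr] at hh ⊢
      linarith

/-- The volume of the slack cube. -/
theorem volume_cube (t₀ : Fin k → ℝ) (σ : ℝ) :
    volume {t : Fin k → ℝ | ∀ i, |t i - t₀ i| < σ / 3} = ENNReal.ofReal (2 * σ / 3) ^ k := by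
  have : {t : Fin k → ℝ | ∀ i, |t i - t₀ i| < σ / 3} =
      univ.pi fun i => Ioo (t₀ i - σ / 3) (t₀ i + σ / 3) := by
    ext t
    simp only [mem_setOf_eq, mem_pi, mem_univ, true_implies, mem_Ioo, abs_sub_lt_iff]
    exact forall_congr' fun i => ⟨fun h => ⟨by linarith [h.2], by linarith [h.1]⟩,
      fun h => ⟨by linarith [h.2], by linarith [h.1]⟩⟩
  rw [this, Real.volume_pi_Ioo]
  rw [show (fun i : Fin k => ENNReal.ofReal (t₀ i + σ / 3 - (t₀ i - σ / 3))) =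
    fun _ => ENNReal.ofReal (2 * σ / 3) from funext fun i => by ring_nf]
  simp

/-- **Lower bound for the fibre mass near a valuation with a slack point.** -/
theorem lmass_ge_of_slack (lo hi : Fin k → Fin k ⊕ ι) (a : Fin k → Option ι) (α α' : ι → ℝ)
    (t₀ : Fin k → ℝ) {σ D : ℝ} (hD : 1 ≤ D)
    (hslack : ∀ i, Sum.elim t₀ α (lo i) + σ ≤ t₀ i ∧ t₀ i + σ ≤ Sum.elim t₀ α (hi i))
    (hα' : ∀ i c, (lo i = Sum.inr c ∨ hi i = Sum.inr c) → |α' c - α c| ≤ σ / 3)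
    (hDα' : ∀ t ∈ cell lo hi α', ∀ i c, a i = some c → |t i - α' c| ≤ D) :
    ENNReal.ofReal D⁻¹ ^ k * ENNReal.ofReal (2 * σ / 3) ^ k ≤ lmass lo hi a α' := by
  rw [← volume_cube t₀ σ]
  exact (mul_le_mul_right (measure_mono (cube_subset_cell lo hi α α' t₀ σ hslack hα')) _).trans
    (lmass_ge_volume lo hi a α' hD hDα')

end SepTwo

/-- **Lower bound for the fibre mass near a valuation with a slack point** (registered sub-goal
of `stub_separateTwo`; literal form of `SepTwo.lmass_ge_of_slack`): if the cell of `α` contains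
a point `t₀` with slack `σ`, `α'` is within `σ/3` of `α` on the bound atoms, and on the cell
of `α'` every lettered coordinate is within `D ≥ 1` of its letter, then the fibre mass of `α'` is
at least `(2σ/(3D))^k`. -/
theorem separateTwo_volume (k : ℕ) (ι : Type) (lo hi : Fin k → Fin k ⊕ ι) (a : Fin k → Option ι) (α α' : ι → ℝ) (t₀ : Fin k → ℝ) (σ D : ℝ) (hD : 1 ≤ D) (hslack : ∀ i, Sum.elim t₀ α (lo i) + σ ≤ t₀ i ∧ t₀ i + σ ≤ Sum.elim t₀ α (hi i)) (hα' : ∀ i c, (lo i = Sum.inr c ∨ hi i = Sum.inr c) → |α' c - α c| ≤ σ / 3) (hDα' : ∀ t ∈ {t : Fin k → ℝ | ∀ i, Sum.elim t α' (lo i) < t i ∧ t i < Sum.elim t α' (hi i)}, ∀ i c, a i = some c → |t i - α' c| ≤ D) : ENNReal.ofReal D⁻¹ ^ k * ENNReal.ofReal (2 * σ / 3) ^ k ≤ MeasureTheory.lintegral (MeasureTheory.volume.restrict {t : Fin k → ℝ | ∀ i, Sum.elim t α' (lo i) < t i ∧ t i < Sum.elim t α' (hi i)}) (fun t => ∏ i,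 (a i).elim 1 (fun c => ENNReal.ofReal |t i - α' c|⁻¹)) := by
  exact SepTwo.lmass_ge_of_slack lo hi a α α' t₀ hD hslack hα' hDα'

end Summit.KontsevichZagierPeriods.ArrangementNormalForm.JanusBands
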